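import Mathlib

/-!
# GirthSidon — sparse engine, part A: labelled paths and the two-paths relation

Support file for item `stmt-ValiantsHypothesis-6539` (`SparseSwallowForcesShortRelation`) of route
`GirthSidon` (problem `ValiantsHypothesis`).

Combinatorial core, stated without `SimpleGraph`: vertices are integers, `nbr c` is the (finite)
neighbourhood of `c`, and every ordered adjacent pair `(b, c)` carries a label `lab b c : ι` whose
weight is `d (lab b c) = b + c`.  Along a path `a = b₀ ~ b₁ ~ ⋯ ~ bₙ` the alternating sum of the
edge weights telescopes to `bₙ ± a`, so two distinct vertex-simple paths of the same length with
the same endpoints give two DIFFERENT multisets of labels (even positions of one path plus odd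
positions of the other, and conversely) with equal `d`-sums — a "short additive relation".
Counting vertex-simple paths from a vertex of a graph of minimum degree `δ`
(at least `(δ - n)^n` of length `n`) and pigeonholing on the endpoint produces such a pair as soon
as `(δ - k)^k` exceeds the number of vertices (Moore-bound argument; this replaces the even-cycle /
Bondy–Simonovits step of the route text and needs no bipartite reduction).

Paths are lists, newest vertex first (`[bₙ, …, b₁, b₀]`): `List.IsChain (fun b c => b ∈ nbr c)`,
`List.Nodup`, `List.getLast? = some a`.  The pair `eo p = (S, T)` of label multisets in even /
odd positions (counted from the newest edge) is treated axiomatically through its two recursion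
equations (`heo01`, `heo2`); the one instance needed is built inside the final proof as a
`List.foldr` over consecutive pairs, so the file introduces no definitions.
-/

-- `Summit.ValiantsHypothesis.ValiantsHypothesis.…` is the tree's mandated single-conjunct layout
-- (Sub = Summit), so the duplicated namespace component is intended (as in all Theorems files).
set_option linter.dupNamespace false

namespace Summit.ValiantsHypothesis.ValiantsHypothesis.Theorems.GirthSidonSparse

variable {ι : Type*}

/-- Size bookkeeping: a list of length `L` has at most `⌈(L-1)/2⌉` even-position edges and at most
`⌊(L-1)/2⌋` odd-position edges. -/
theorem card_evenOdd_le (lab : ℤ → ℤ → ι) (eo : List ℤ → Multiset ι × Multiset ι)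
    (heo01 : ∀ q : List ℤ, q.length ≤ 1 → eo q = (0, 0))
    (heo2 : ∀ (b c : ℤ) (rest : List ℤ),
      eo (b :: c :: rest) = (lab b c ::ₘ (eo (c :: rest)).2, (eo (c :: rest)).1)) :
    ∀ p : List ℤ, 2 * Multiset.card (eo p).1 ≤ p.length ∧
      2 * Multiset.card (eo p).2 ≤ p.length - 1
  | [] => by simp [heo01 [] (by simp)]
  | [x] => by simp [heo01 [x] (by simp)]
  | b :: c :: rest => by
      have ih := card_evenOdd_le lab eo heo01 heo2 (c :: rest)
      rw [heo2]
      simp only [Multiset.card_cons, List.length_cons] at ih ⊢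
      omega

/-- Every label occurring along a chain is the label of two consecutive (adjacent) vertices. -/
theorem exists_of_mem_evenOdd (lab : ℤ → ℤ → ι) (eo : List ℤ → Multiset ι × Multiset ι)
    (heo01 : ∀ q : List ℤ, q.length ≤ 1 → eo q = (0, 0))
    (heo2 : ∀ (b c : ℤ) (rest : List ℤ),
      eo (b :: c :: rest) = (lab b c ::ₘ (eo (c :: rest)).2, (eo (c :: rest)).1))
    (nbr : ℤ → Finset ℤ) :
    ∀ p : List ℤ, p.IsChain (fun b c => b ∈ nbr c) → ∀ x : ι,
      (x ∈ (eo p).1 ∨ x ∈ (eo p).2) → ∃ y z : ℤ, y ∈ p ∧ z ∈ p ∧ y ∈ nbr z ∧ x = lab y z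
  | [], _, x, hx => by simp [heo01 [] (by simp)] at hx
  | [c], _, x, hx => by simp [heo01 [c] (by simp)] at hx
  | b :: c :: rest, hp, x, hx => by
      rw [List.isChain_cons_cons] at hp
      rw [heo2] at hx
      simp only [Multiset.mem_cons] at hx
      rcases hx with (rfl | hx) | hx
      · exact ⟨b, c, by simp, by simp, hp.1, rfl⟩
      · obtain ⟨y, z, hy, hz, hyz, rfl⟩ :=
          exists_of_mem_evenOdd lab eo heo01 heo2 nbr (c :: rest) hp.2 x (Or.inr hx)
        exact ⟨y, z, List.mem_cons_of_mem _ hy, List.mem_cons_of_mem _ hz, hyz, rfl⟩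
      · obtain ⟨y, z, hy, hz, hyz, rfl⟩ :=
          exists_of_mem_evenOdd lab eo heo01 heo2 nbr (c :: rest) hp.2 x (Or.inl hx)
        exact ⟨y, z, List.mem_cons_of_mem _ hy, List.mem_cons_of_mem _ hz, hyz, rfl⟩

/-- Telescoping: along a chain ending (oldest vertex) at `a` with newest vertex `b`, the
alternating sum of the edge weights `d (lab y z) = y + z` equals `b + (-1)^{length} · a`. -/
theorem sum_evenOdd (lab : ℤ → ℤ → ι) (eo : List ℤ → Multiset ι × Multiset ι)
    (heo01 : ∀ q : List ℤ, q.length ≤ 1 → eo q = (0, 0))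
    (heo2 : ∀ (b c : ℤ) (rest : List ℤ),
      eo (b :: c :: rest) = (lab b c ::ₘ (eo (c :: rest)).2, (eo (c :: rest)).1))
    (nbr : ℤ → Finset ℤ) (a : ℤ) (d : ι → ℤ)
    (hlab : ∀ b c : ℤ, b ∈ nbr c → d (lab b c) = b + c) :
    ∀ p : List ℤ, p.IsChain (fun b c => b ∈ nbr c) → p.getLast? = some a →
      ((eo p).1.map d).sum - ((eo p).2.map d).sum = p.headI + (-1) ^ p.length * a
  | [], _, h => by simp at h
  | [x], _, h => by
      simp only [List.getLast?_singleton, Option.some.injEq] at h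
      subst h
      simp [heo01 [x] (by simp)]
  | b :: c :: rest, hp, hl => by
      rw [List.isChain_cons_cons] at hp
      rw [List.getLast?_cons_cons] at hl
      have ih := sum_evenOdd lab eo heo01 heo2 nbr a d hlab (c :: rest) hp.2 hl
      rw [heo2]
      simp only [Multiset.map_cons, Multiset.sum_cons, List.headI_cons, List.length_cons] at ih ⊢
      rw [hlab b c hp.1]
      have h2 : (-1 : ℤ) ^ (rest.length + 1 + 1) = -(-1) ^ (rest.length + 1) := by
        rw [pow_succ]; ring
      rw [h2]
      linarith

/-- **Two paths give a short relation.**  Two distinct vertex-simple paths (chains without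
repeated vertices) from `a` of the same length `n` with the same final vertex yield multisets
`S ≠ T` of labels, each of size `≤ n`, with equal `d`-sums.  Hypotheses on the labelling: the
weight of the label of an adjacent pair is the sum of its endpoints (`hlab1`), and a label
determines its (unordered) pair of endpoints (`hlab2`). -/
theorem relation_of_two_paths (lab : ℤ → ℤ → ι) (eo : List ℤ → Multiset ι × Multiset ι)
    (heo01 : ∀ q : List ℤ, q.length ≤ 1 → eo q = (0, 0))
    (heo2 : ∀ (b c : ℤ) (rest : List ℤ),
      eo (b :: c :: rest) = (lab b c ::ₘ (eo (c :: rest)).2, (eo (c :: rest)).1))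
    (nbr : ℤ → Finset ℤ) (a : ℤ) (d : ι → ℤ)
    (hlab1 : ∀ b c : ℤ, b ∈ nbr c → d (lab b c) = b + c)
    (hlab2 : ∀ b c y z : ℤ, b ∈ nbr c → y ∈ nbr z → lab b c = lab y z → b = y ∨ b = z) :
    ∀ (n : ℕ) (p p' : List ℤ),
      p.IsChain (fun b c => b ∈ nbr c) → p.Nodup → p.getLast? = some a →
      p'.IsChain (fun b c => b ∈ nbr c) → p'.Nodup → p'.getLast? = some a →
      p.length = n + 1 → p'.length = n + 1 → p.headI = p'.headI → p ≠ p' →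
      ∃ S T : Multiset ι, S ≠ T ∧ Multiset.card S ≤ n ∧ Multiset.card T ≤ n ∧
        (S.map d).sum = (T.map d).sum := by
  intro n
  induction n with
  | zero =>
      intro p p' _ _ hl _ _ hl' hlen hlen' _ hne
      exfalso
      match p, p', hlen, hlen', hl, hl' with
      | [x], [x'], _, _, hx, hx' =>
          simp only [List.getLast?_singleton, Option.some.injEq] at hx hx'
          subst hx; subst hx'
          exact hne rfl
  | succ n ih =>
      intro p p' hc hnd hl hc' hnd' hl' hlen hlen' hhead hne
      match p, p', hlen, hlen', hc, hnd, hl, hc', hnd', hl', hhead, hne with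
      | b :: c :: r, b' :: c' :: r', hlen, hlen', hc, hnd, hl, hc', hnd', hl', hhead, hne =>
          simp only [List.headI_cons] at hhead
          subst hhead
          simp only [List.length_cons, Nat.add_right_cancel_iff] at hlen hlen'
          have hpc := List.isChain_cons_cons.1 hc
          have hpc' := List.isChain_cons_cons.1 hc'
          have hbn := List.nodup_cons.1 hnd
          have hbn' := List.nodup_cons.1 hnd'
          rw [List.getLast?_cons_cons] at hl hl'
          by_cases hcc : c = c'
          · subst hcc
            have hq : (c :: r) ≠ (c :: r') := by
              intro h
              apply hne
              rw [(List.cons_injective (a := c)) h]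
            obtain ⟨S, T, hST, hS, hT, hsum⟩ :=
              ih (c :: r) (c :: r') hpc.2 hbn.2 hl hpc'.2 hbn'.2 hl' (by simpa using hlen)
                (by simpa using hlen') (by simp) hq
            exact ⟨S, T, hST, by omega, by omega, hsum⟩
          · -- the two paths diverge at their newest edge: combine even/odd labels crosswise
            refine ⟨(eo (b :: c :: r)).1 + (eo (b :: c' :: r')).2,
              (eo (b :: c :: r)).2 + (eo (b :: c' :: r')).1, ?_, ?_, ?_, ?_⟩
            · -- `lab b c` lies in the first multiset but not in the second
              intro hEq
              have hx : lab b c ∈ (eo (b :: c :: r)).2 + (eo (b :: c' :: r')).1 := by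
                rw [← hEq, heo2]
                simp
              rw [heo2, heo2] at hx
              simp only [Multiset.mem_add, Multiset.mem_cons] at hx
              rcases hx with hx | hx | hx
              · obtain ⟨y, z, hy, hz, hyz, hl⟩ :=
                  exists_of_mem_evenOdd lab eo heo01 heo2 nbr (c :: r) hpc.2 (lab b c) (Or.inl hx)
                rcases hlab2 b c y z hpc.1 hyz hl with rfl | rfl
                · exact hbn.1 hy
                · exact hbn.1 hz
              · have h1 := hlab1 b c hpc.1
                have h2 := hlab1 b c' hpc'.1
                rw [hx] at h1
                exact hcc (by linarith)
              · obtain ⟨y, z, hy, hz, hyz, hl⟩ :=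
                  exists_of_mem_evenOdd lab eo heo01 heo2 nbr (c' :: r') hpc'.2 (lab b c)
                    (Or.inr hx)
                rcases hlab2 b c y z hpc.1 hyz hl with rfl | rfl
                · exact hbn'.1 hy
                · exact hbn'.1 hz
            · have h1 := card_evenOdd_le lab eo heo01 heo2 (b :: c :: r)
              have h2 := card_evenOdd_le lab eo heo01 heo2 (b :: c' :: r')
              simp only [List.length_cons, Multiset.card_add] at h1 h2 ⊢
              omega
            · have h1 := card_evenOdd_le lab eo heo01 heo2 (b :: c :: r)
              have h2 := card_evenOdd_le lab eo heo01 heo2 (b :: c' :: r')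
              simp only [List.length_cons, Multiset.card_add] at h1 h2 ⊢
              omega
            · have h1 := sum_evenOdd lab eo heo01 heo2 nbr a d hlab1 (b :: c :: r) hc
                (by rwa [List.getLast?_cons_cons])
              have h2 := sum_evenOdd lab eo heo01 heo2 nbr a d hlab1 (b :: c' :: r') hc'
                (by rwa [List.getLast?_cons_cons])
              simp only [List.headI_cons, List.length_cons, hlen, hlen'] at h1 h2
              simp only [Multiset.map_add, Multiset.sum_add]
              linarith

/-- **Moore-type count.**  With minimum degree `δ` inside `W` (all neighbourhoods lying in `W`),
from any `a ∈ W` there are at least `(δ - n)^n` vertex-simple paths of length `n`, all with their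
newest vertex in `W`. -/
theorem exists_many_paths (nbr : ℤ → Finset ℤ) (a : ℤ) (W : Finset ℤ) (δ : ℕ)
    (hnW : ∀ c, nbr c ⊆ W) (ha : a ∈ W) (hdeg : ∀ c ∈ W, δ ≤ (nbr c).card) :
    ∀ n : ℕ, ∃ P : Finset (List ℤ), (δ - n) ^ n ≤ P.card ∧
      ∀ p ∈ P, p.IsChain (fun b c => b ∈ nbr c) ∧ p.Nodup ∧ p.getLast? = some a ∧
        p.length = n + 1 ∧ p.headI ∈ W := by
  intro n
  induction n with
  | zero =>
      refine ⟨{[a]}, by simp, ?_⟩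
      intro p hp
      rw [Finset.mem_singleton] at hp
      subst hp
      exact ⟨List.isChain_singleton _, List.nodup_singleton _, rfl, rfl, by simpa using ha⟩
  | succ n ih =>
      obtain ⟨P, hcardP, hP⟩ := ih
      classical
      refine ⟨P.biUnion fun p => ((nbr p.headI) \ p.toFinset).image fun b => b :: p, ?_, ?_⟩
      · have hdisj : (P : Set (List ℤ)).PairwiseDisjoint
            fun p => ((nbr p.headI) \ p.toFinset).image fun b => b :: p := by
          intro p _ q _ hpq
          simp only [Function.onFun]
          rw [Finset.disjoint_left]
          intro x hx hx'
          simp only [Finset.mem_image] at hx hx'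
          obtain ⟨b, _, rfl⟩ := hx
          obtain ⟨b', _, h⟩ := hx'
          exact hpq ((List.cons.inj h).2).symm
        have hterm : ∀ p ∈ P,
            δ - (n + 1) ≤ (((nbr p.headI) \ p.toFinset).image fun b => b :: p).card := by
          intro p hp
          rw [Finset.card_image_of_injective _ (fun x y h => (List.cons.inj h).1)]
          have h1 := Finset.le_card_sdiff p.toFinset (nbr p.headI)
          have h2 := List.toFinset_card_le p
          have h3 := hdeg _ (hP p hp).2.2.2.2
          have h4 := (hP p hp).2.2.2.1
          omega
        calc (δ - (n + 1)) ^ (n + 1) = (δ - (n + 1)) ^ n * (δ - (n + 1)) := pow_succ _ _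
          _ ≤ (δ - n) ^ n * (δ - (n + 1)) :=
              Nat.mul_le_mul_right _ (Nat.pow_le_pow_left (by omega) n)
          _ ≤ P.card * (δ - (n + 1)) := Nat.mul_le_mul_right _ hcardP
          _ = ∑ _p ∈ P, (δ - (n + 1)) := by simp
          _ ≤ ∑ p ∈ P, (((nbr p.headI) \ p.toFinset).image fun b => b :: p).card :=
              Finset.sum_le_sum hterm
          _ = (P.biUnion fun p => ((nbr p.headI) \ p.toFinset).image fun b => b :: p).card :=
              (Finset.card_biUnion hdisj).symm
      · intro q hq
        simp only [Finset.mem_biUnion, Finset.mem_image, Finset.mem_sdiff, List.mem_toFinset] at hq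
        obtain ⟨p, hp, b, ⟨hb, hbp⟩, rfl⟩ := hq
        obtain ⟨hc, hnd, hl, hlen, _⟩ := hP p hp
        match p, hc, hnd, hl, hlen, hb, hbp with
        | c :: r, hc, hnd, hl, hlen, hb, hbp =>
            simp only [List.headI_cons] at hb
            refine ⟨List.isChain_cons_cons.2 ⟨hb, hc⟩, List.nodup_cons.2 ⟨hbp, hnd⟩, ?_, ?_, ?_⟩
            · rw [List.getLast?_cons_cons]; exact hl
            · simp only [List.length_cons] at hlen ⊢
              omega
            · simpa using hnW _ hb

/-- **Part A, main.**  In a labelled graph on `W ⊂ ℤ` with minimum degree `δ` and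
`|W| < (δ - k)^k`, there are multisets `S ≠ T` of labels of size `≤ k` with equal `d`-sums. -/
theorem exists_relation_of_minDegree (lab : ℤ → ℤ → ι) (nbr : ℤ → Finset ℤ) (d : ι → ℤ)
    (hlab1 : ∀ b c : ℤ, b ∈ nbr c → d (lab b c) = b + c)
    (hlab2 : ∀ b c y z : ℤ, b ∈ nbr c → y ∈ nbr z → lab b c = lab y z → b = y ∨ b = z)
    (W : Finset ℤ) (hnW : ∀ c, nbr c ⊆ W) (δ k : ℕ) (hdeg : ∀ c ∈ W, δ ≤ (nbr c).card)
    (a : ℤ) (ha : a ∈ W) (hk : W.card < (δ - k) ^ k) :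
    ∃ S T : Multiset ι, S ≠ T ∧ Multiset.card S ≤ k ∧ Multiset.card T ≤ k ∧
      (S.map d).sum = (T.map d).sum := by
  obtain ⟨P, hcard, hP⟩ := exists_many_paths nbr a W δ hnW ha hdeg k
  have hc : W.card < P.card := lt_of_lt_of_le hk hcard
  obtain ⟨p, hp, p', hp', hne, hhead⟩ := Finset.exists_ne_map_eq_of_card_lt_of_maps_to hc
    (f := List.headI) (fun p hp => (hP p hp).2.2.2.2)
  obtain ⟨h1, h2, h3, h4, _⟩ := hP p hp
  obtain ⟨h1', h2', h3', h4', _⟩ := hP p' hp'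
  -- the even/odd label multisets, as a fold over consecutive pairs (newest edge first)
  let eo : List ℤ → Multiset ι × Multiset ι := fun q =>
    List.foldr (fun x ST => (x ::ₘ ST.2, ST.1)) (0, 0) (List.zipWith lab q q.tail)
  have heo01 : ∀ q : List ℤ, q.length ≤ 1 → eo q = (0, 0) := by
    intro q hq
    match q, hq with
    | [], _ => rfl
    | [_], _ => rfl
    | _ :: _ :: _, h => simp at h
  have heo2 : ∀ (b c : ℤ) (rest : List ℤ),
      eo (b :: c :: rest) = (lab b c ::ₘ (eo (c :: rest)).2, (eo (c :: rest)).1) :=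
    fun _ _ _ => rfl
  exact relation_of_two_paths lab eo heo01 heo2 nbr a d hlab1 hlab2 k p p' h1 h2 h3 h1' h2' h3'
    h4 h4' hhead hne

end Summit.ValiantsHypothesis.ValiantsHypothesis.Theorems.GirthSidonSparse
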